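import Summits.ABC.IUTFork.F6ForkShadowBridgesDH
import HarnessLib

/-!
# F-2769 `LocalGlobalNumbers.StepVPlace.StepVBound` — INSTANCE FORMS (conclusion head = the row's declaration)

PROOF-ONLY companion (0 `def`, 0 `instance`) of the abc-iut cell, block F (seat abc-iut-f-070, KEY INST59F). It
imports — never edits — `ForkLocalGlobalNumbers` (skel XXV: the Step (v) shadow place `StepVPlace` with its
HYPOTHESIS `StepVBound`, [IUTchIV] Thm. 1.10 proof Step (v) display p. 29) and `F6ForkShadowBridgesDH` (abc-iut-f-136:
the bridge `DHData.stepVBound_iff_estimateDH` to the Dupuy–Hilado multiradial estimate, the ∃-witnesses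
`exists_stepVPlace_stepVBound_of_estimateDH` / `exists_stepVPlace_stepVBound_not_perPlace_rat`, and the closure
refuter `not_forall_stepVBound`).

The FACT-LIST row F-2769 is a SCHEMA (its ∀-closure is refuted; it is consumable only at an instance). The tree so
far certified the instances only through `∃`-statements, which the kernel census (conclusion-head match) does not
see. This file supplies the instance-form theorems proper:

* `StepVPlace.stepVBound_of_estimateDH` — CONDITIONAL instance at any shadow place read off a Dupuy–Hilado datum `D`
  (`l`, `log 𝔮 = deĝ(𝔮)`, `localTheta = [F:ℚ]·(−|log Θ|_DH)`): `D.EstimateDH (κ/[F:ℚ]) → d.StepVBound`;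
* `DHData.stepVBound_readOff` — the same at the EXPLICIT read-off place with `κ := [F:ℚ]·δ`, from `D.EstimateDH δ`;
* `ValLine.stepVBound_readOff_bareWitness` — CLOSED at c312-3's witness B (one place of `F` over each prime under
  `S`, `l ≥ 7`, `κ = 0`): the Step (v) bound HOLDS there (`estimateDH_bareWitness_zero`), while F-2769's closure
  fails at witness A (`not_forall_stepVBound`) — a genuine schema, inhabited by name.

HONEST FRAMING: statements about OUR typed shadow and OUR constructed Dupuy–Hilado data (the valuation-line
witnesses carry no `p`-adic content); nothing here asserts the Step (v) bound for the real setting, takes a side on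
[IUTchIII] Cor. 3.12, or endorses any author; typed ≠ proved; instantiated ≠ endorsed.
[cite: Mochizuki2012, IUTchIV Thm 1.10 proof Step (v) pp. 27–29] [cite: DupuyHilado2025, Thm. 3.10.1]
[claim: Mochizuki2012, status: disputed]
-/

noncomputable section

namespace Summit.ABC.IUTFork

open Literature.IUT.LogVolume NumberField IsDedekindDomain LocalGlobalNumbers

variable {F : Type} [Field F] [NumberField F]

namespace LocalGlobalNumbers.StepVPlace

/-- **F-2769, CONDITIONAL instance form.** For a shadow place `d` READ OFF a Dupuy–Hilado datum `D` (`d.l = l`,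
`d.logq = deĝ(𝔮)`, `d.localTheta = [F:ℚ]·(−|log Θ|_DH)`), the DH multiradial estimate with discrepancy
`d.κ/[F:ℚ]` gives the Step (v) bound at `d` (one direction of abc-iut-f-136's `DHData.stepVBound_iff_estimateDH`,
isolated so that the conclusion head is the row's declaration).
[cite: Mochizuki2012, IUTchIV Thm 1.10 proof Step (v) p. 29] [cite: DupuyHilado2025, Thm. 3.10.1]
[claim: Mochizuki2012, status: disputed] -/
theorem stepVBound_of_estimateDH (D : DHData F) (d : StepVPlace) (hl : d.l = D.X.l)
    (hq : d.logq = FinDivisor.deg F D.X.qDivisor)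
    (hΘ : d.localTheta = (Module.finrank ℚ F : ℝ) * D.negLogThetaDH)
    (h : D.EstimateDH (d.kappa / Module.finrank ℚ F)) : d.StepVBound :=
  (D.stepVBound_iff_estimateDH d hl hq hΘ).mpr h

/-- Conversely, the Step (v) bound at a read-off place IS the DH estimate with the normalised discrepancy (the other
direction, for citation next to the instance form). [cite: DupuyHilado2025, Thm. 3.10.1] [claim: Mochizuki2012, status: disputed] -/
theorem estimateDH_of_stepVBound (D : DHData F) (d : StepVPlace) (hl : d.l = D.X.l)
    (hq : d.logq = FinDivisor.deg F D.X.qDivisor)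
    (hΘ : d.localTheta = (Module.finrank ℚ F : ℝ) * D.negLogThetaDH) (h : d.StepVBound) :
    D.EstimateDH (d.kappa / Module.finrank ℚ F) :=
  (D.stepVBound_iff_estimateDH d hl hq hΘ).mp h

end LocalGlobalNumbers.StepVPlace

namespace DHData

variable (D : DHData F)

/-- **F-2769, instance form at the EXPLICIT read-off place.** For `l ≥ 7` and `δ ≥ 0`, the shadow place
`⟨l, [F:ℚ]·δ, deĝ(𝔮), [F:ℚ]·(−|log Θ|_DH)⟩` read off `D` satisfies the Step (v) bound as soon as `D.EstimateDH δ`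
(the place of abc-iut-f-136's `exists_stepVPlace_stepVBound_of_estimateDH`, named).
[cite: Mochizuki2012, IUTchIV Thm 1.10 proof Step (v) p. 29] [cite: DupuyHilado2025, Thm. 3.10.1]
[claim: Mochizuki2012, status: disputed] -/
theorem stepVBound_readOff (h7 : 7 ≤ D.X.l) {δ : ℝ} (hδ : 0 ≤ δ) (h : D.EstimateDH δ) :
    (⟨D.X.l, h7, (Module.finrank ℚ F : ℝ) * δ, mul_nonneg (Nat.cast_nonneg _) hδ,
        FinDivisor.deg F D.X.qDivisor, D.X.deg_qDivisor_pos.le,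
        (Module.finrank ℚ F : ℝ) * D.negLogThetaDH⟩ : StepVPlace).StepVBound := by
  have hF : (Module.finrank ℚ F : ℝ) ≠ 0 := (FinDivisor.finrank_pos (F := F)).ne'
  refine StepVPlace.stepVBound_of_estimateDH D _ rfl rfl rfl ?_
  show D.EstimateDH ((Module.finrank ℚ F : ℝ) * δ / Module.finrank ℚ F)
  rwa [mul_div_cancel_left₀ δ hF]

end DHData

namespace ValLine

variable (X : PilotData F)

/-- **F-2769, instance form CLOSED at c312-3's witness B** (no (Ind3)-enlargement; one place of `F` over each prime
under `S`; `l ≥ 7` as in [IUTchIV] Thm. 1.10): the read-off place of `bareWitness X` with `κ = 0` satisfies the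
Step (v) bound — `estimateDH_bareWitness_zero` through the bridge. Together with `not_forall_stepVBound` (failure at
witness A) the row is a genuine schema, inhabited BY NAME. [cite: Mochizuki2012, IUTchIV Thm 1.10 proof Step (v) p. 29]
[claim: Mochizuki2012, status: disputed] -/
theorem stepVBound_readOff_bareWitness (h7 : 7 ≤ X.l)
    (h : ∀ p ∈ primesUnder X, ∀ v w : placesOver F p, v = w) :
    (⟨X.l, h7, 0, le_rfl, FinDivisor.deg F X.qDivisor, X.deg_qDivisor_pos.le,
        (Module.finrank ℚ F : ℝ) * (bareWitness X).negLogThetaDH⟩ : StepVPlace).StepVBound := by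
  refine StepVPlace.stepVBound_of_estimateDH (bareWitness X) _ rfl rfl rfl ?_
  show (bareWitness X).EstimateDH ((0 : ℝ) / Module.finrank ℚ F)
  rw [zero_div]
  exact estimateDH_bareWitness_zero X h

end ValLine

/-- **F-2769 at once**: the Step (v) shadow bound HOLDS at a named constructed place (witness B over `ℚ`, `l = 7`,
pilot data from `ValLine.exists_pilotData_rat_seven`) and its ∀-closure FAILS (`not_forall_stepVBound`, witness A) —
a satisfiable, non-tautological schema. [claim: Mochizuki2012, status: disputed] -/
theorem stepVBound_schema :
    (∃ d : StepVPlace, d.StepVBound) ∧ ¬ ∀ d : StepVPlace, d.StepVBound := by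
  refine ⟨?_, not_forall_stepVBound⟩
  obtain ⟨X, hl, hX⟩ := ValLine.exists_pilotData_rat_seven
  exact ⟨_, ValLine.stepVBound_readOff_bareWitness X (by omega) hX⟩

end Summit.ABC.IUTFork

end
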